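import Literature.NumberTheory.IwasawaTheory.ClassicalMuVanishesZywinaG9FiveDescent
import Literature.NumberTheory.EllipticCurves.ModFiveImageZywinaG9Exponent
import Mathlib.GroupTheory.Perm.Cycle.Type
import HarnessLib

set_option autoImplicit false

/-!
# `μ = 0` for a Galois number field with a faithful representation into Zywina's `G₉ ⊂ GL₂(𝔽₅)` (`5S4`): the bridge from matrices
# over `𝔽₅` to the `G₉` census form

Topic `NumberTheory/IwasawaTheory` (namespace = path).  THEOREM-ONLY file (no definition, no named fact, no `sorry`); literature
seat `bsd-potss-conjA-anchor` g12 (supports stmt-BirchSwinnertonDyer-19413, the KT rows with image `5S4`; closes nothing).  Companion of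
`ClassicalMuVanishesZywinaG9FiveDescent.lean`, in the vocabulary of the tree's `Zywina2015G9.G9` (`EllipticCurves/ModFiveImageZywinaG9`:
the subgroup of `GL₂(𝔽₅)` generated by `(2 0; 0 1)`, `(1 0; 0 2)`, `(0 −1; 1 0)`, `(1 1; 1 −1)`):

* `classicalMuVanishes_of_isCyclotomic_of_zywinaG9_five_fixedField` — `L/ℚ` Galois, `ρ : Gal(L/ℚ) →* M₂(𝔽₅)` INJECTIVE with values in
  `G₉`, `u, w, t ∈ Gal(L/ℚ)` with `ρ u = diag(1, 2)`, `ρ w = (0 4; 1 0)`, `ρ t = (1 1; 1 4)`: then `u⁴ = w⁴ = 1`, `w²u = uw²`,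
  `w u² w⁻¹ = w²u²`, `w²t = tw²`, `t u² t⁻¹ = w u²` (by `decide` on the matrices) and `5 ∤ [L : ℚ]` (every element of `G₉` has order
  dividing `24`, `Zywina2015G9.coe_pow_twentyfour_eq_one_of_mem_G9`), so the census form
  `classicalMuVanishes_of_isCyclotomic_of_zywinaG9_kuroda_rat` applies: «`μ = 0` for every cyclotomic `ℤ₅`-extension» of the six fixed
  fields `L^{⟨u⟩}` (`= ℚ(P)` for `L = ℚ(E[5])`, degree 24), `L^{⟨w²,u²⟩}` (24), `L^{⟨uw²⟩}` (24), `L^{⟨w⟩}` (24), `L^{⟨u,w²⟩}` (12),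
  `L^{⟨w,u²⟩}` (12) gives the same for `L`.  NO named fact is used.

References: [Zywina2015, §1.3]; [Serre1972, §2.5–2.6]; [Lemmermeyer1994, §1]; [Washington1997, §13.1].
-/

noncomputable section

open scoped NumberField

open Field IntermediateField Literature.NumberTheory.EllipticCurves Literature.NumberTheory.EllipticCurves.Zywina2015G9

namespace Literature.NumberTheory.IwasawaTheory

/-- The relations of `U = diag(1,2)`, `W = (0 4; 1 0)`, `T = (1 1; 1 4)` in `GL₂(𝔽₅)`: `U⁴ = W⁴ = 1`, `T⁸ = 1`, `W²U = UW²`,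
`W U² W³ = W²U²`, `W²T = TW²`, `T U² T⁷ = W U²`. [cite: Zywina2015, §1.3 (generators of G₉)] -/
private theorem G9_generator_relations :
    (!![1, 0; 0, 2] : Matrix (Fin 2) (Fin 2) (ZMod 5)) ^ 4 = 1 ∧ (!![0, 4; 1, 0] : Matrix (Fin 2) (Fin 2) (ZMod 5)) ^ 4 = 1 ∧
    (!![1, 1; 1, 4] : Matrix (Fin 2) (Fin 2) (ZMod 5)) ^ 8 = 1 ∧
    (!![0, 4; 1, 0] : Matrix (Fin 2) (Fin 2) (ZMod 5)) ^ 2 * !![1, 0; 0, 2] = !![1, 0; 0, 2] * (!![0, 4; 1, 0] : Matrix (Fin 2) (Fin 2) (ZMod 5)) ^ 2 ∧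
    (!![0, 4; 1, 0] : Matrix (Fin 2) (Fin 2) (ZMod 5)) * !![1, 0; 0, 2] ^ 2 * !![0, 4; 1, 0] ^ 3 =
      (!![0, 4; 1, 0] : Matrix (Fin 2) (Fin 2) (ZMod 5)) ^ 2 * !![1, 0; 0, 2] ^ 2 ∧
    (!![0, 4; 1, 0] : Matrix (Fin 2) (Fin 2) (ZMod 5)) ^ 2 * !![1, 1; 1, 4] = !![1, 1; 1, 4] * (!![0, 4; 1, 0] : Matrix (Fin 2) (Fin 2) (ZMod 5)) ^ 2 ∧
    (!![1, 1; 1, 4] : Matrix (Fin 2) (Fin 2) (ZMod 5)) * !![1, 0; 0, 2] ^ 2 * !![1, 1; 1, 4] ^ 7 =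
      (!![0, 4; 1, 0] : Matrix (Fin 2) (Fin 2) (ZMod 5)) * !![1, 0; 0, 2] ^ 2 := by
  decide

/-- **`μ = 0` for `L` from a faithful `G₉`-valued representation and six fixed fields (fact-free).**  `L/ℚ` finite Galois,
`ρ : Gal(L/ℚ) →* M₂(𝔽₅)` injective with values in Zywina's `G₉`, `u, w, t ∈ Gal(L/ℚ)` with `ρ u = diag(1,2)`, `ρ w = (0 −1; 1 0)`,
`ρ t = (1 1; 1 −1)`.  Then the `G₉` relations hold for `u, w, t`, `5 ∤ [L : ℚ]`, and «`μ = 0` for every cyclotomic `ℤ₅`-extension» of the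
fixed fields of `⟨u⟩`, `⟨w², u²⟩`, `⟨u w²⟩`, `⟨w⟩`, `⟨u, w²⟩`, `⟨w, u²⟩` gives the same for `L`
(`classicalMuVanishes_of_isCyclotomic_of_zywinaG9_kuroda_rat`).  For `L = ℚ(E[5])` with image `G₉` in a basis `(P, Q)` of `E[5]`:
`L^{⟨u⟩} = ℚ(P)` (degree 24), `L^{⟨w²,u²⟩} = ℚ(x(P), x(Q))` (24), `L^{⟨u,w²⟩} = ℚ(x(P))` (12).  NO named fact.
[cite: Zywina2015, §1.3 (G₉ and its generators)] [cite: Lemmermeyer1994, §1 (Kuroda's class number formula, odd part)]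
[cite: Washington1997, §13.1] -/
theorem classicalMuVanishes_of_isCyclotomic_of_zywinaG9_five_fixedField [Fact (Nat.Prime 5)]
    (L : Type) [Field L] [NumberField L] [IsGalois ℚ L]
    (ρ : (L ≃ₐ[ℚ] L) →* Matrix (Fin 2) (Fin 2) (ZMod 5)) (hρ : Function.Injective ρ)
    (himg : ∀ g, ∃ M ∈ G9, ρ g = ((M : GL (Fin 2) (ZMod 5)) : Matrix (Fin 2) (Fin 2) (ZMod 5))) {u w t : L ≃ₐ[ℚ] L}
    (hρu : ρ u = !![1, 0; 0, 2]) (hρw : ρ w = !![0, 4; 1, 0]) (hρt : ρ t = !![1, 1; 1, 4])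
    (hμP : ∀ κE : ZpExtension ↥(fixedField (Subgroup.zpowers u)) 5, κE.IsCyclotomic → ClassicalMuVanishes κE)
    (hμA₁ : ∀ κE : ZpExtension ↥(fixedField (Subgroup.zpowers (w ^ 2) ⊔ Subgroup.zpowers (u ^ 2))) 5,
      κE.IsCyclotomic → ClassicalMuVanishes κE)
    (hμA₂ : ∀ κE : ZpExtension ↥(fixedField (Subgroup.zpowers (u * w ^ 2))) 5, κE.IsCyclotomic → ClassicalMuVanishes κE)
    (hμA₃ : ∀ κE : ZpExtension ↥(fixedField (Subgroup.zpowers w)) 5, κE.IsCyclotomic → ClassicalMuVanishes κE)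
    (hμB₁ : ∀ κE : ZpExtension ↥(fixedField (Subgroup.zpowers u ⊔ Subgroup.zpowers (w ^ 2))) 5,
      κE.IsCyclotomic → ClassicalMuVanishes κE)
    (hμD : ∀ κE : ZpExtension ↥(fixedField (Subgroup.zpowers w ⊔ Subgroup.zpowers (u ^ 2))) 5,
      κE.IsCyclotomic → ClassicalMuVanishes κE)
    (κL : ZpExtension L 5) (hκL : κL.IsCyclotomic) : ClassicalMuVanishes κL := by
  classical
  obtain ⟨fU, fW, fT, fCU, fWU, fCT, fTU⟩ := G9_generator_relations
  -- relations among `u, w, t`, read off the matrices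
  have hu : u ^ 4 = 1 := hρ (by simp only [map_pow, map_one, hρu]; exact fU)
  have hw : w ^ 4 = 1 := hρ (by simp only [map_pow, map_one, hρw]; exact fW)
  have ht : t ^ 8 = 1 := hρ (by simp only [map_pow, map_one, hρt]; exact fT)
  have hwinv : w⁻¹ = w ^ 3 := inv_eq_of_mul_eq_one_right (by rw [← pow_succ']; exact hw)
  have htinv : t⁻¹ = t ^ 7 := inv_eq_of_mul_eq_one_right (by rw [← pow_succ']; exact ht)
  have hcu : w ^ 2 * u = u * w ^ 2 := hρ (by simp only [map_mul, map_pow, hρu, hρw]; exact fCU)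
  have hwu : w * u ^ 2 * w⁻¹ = w ^ 2 * u ^ 2 := by
    rw [hwinv]; exact hρ (by simp only [map_mul, map_pow, hρu, hρw]; exact fWU)
  have hct : w ^ 2 * t = t * w ^ 2 := hρ (by simp only [map_mul, map_pow, hρw, hρt]; exact fCT)
  have htu : t * u ^ 2 * t⁻¹ = w * u ^ 2 := by
    rw [htinv]; exact hρ (by simp only [map_mul, map_pow, hρu, hρw, hρt]; exact fTU)
  -- `5 ∤ [L : ℚ]`: every `g` has `g²⁴ = 1`
  have h24 : ∀ g : L ≃ₐ[ℚ] L, g ^ 24 = 1 := fun g => by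
    obtain ⟨M, hM, hgM⟩ := himg g
    exact hρ (by rw [map_pow, hgM, map_one]; exact coe_pow_twentyfour_eq_one_of_mem_G9 hM)
  have hp : ¬ 5 ∣ Module.finrank ℚ L := by
    intro h5
    rw [← IsGalois.card_aut_eq_finrank, Nat.card_eq_fintype_card] at h5
    obtain ⟨g, hg⟩ := exists_prime_orderOf_dvd_card 5 h5
    have h1 : orderOf g ∣ 24 := orderOf_dvd_of_pow_eq_one (h24 g)
    rw [hg] at h1
    exact absurd h1 (by norm_num)
  exact classicalMuVanishes_of_isCyclotomic_of_zywinaG9_kuroda_rat (p := 5) (by norm_num) L hp hu hw hcu hwu hct htu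
    hμP hμA₁ hμA₂ hμA₃ hμB₁ hμD κL hκL

end Literature.NumberTheory.IwasawaTheory

end
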